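import Literature.AlgebraicGeometry.Resolution.AffineBlowup
import Literature.AlgebraicGeometry.Resolution.ResolutionOfSingularities
import Literature.RingTheory.LocalCohomology.CechFiniteness
import Mathlib.RingTheory.Localization.LocalizationLocalization
import Mathlib.RingTheory.RegularLocalRing.Defs
import HarnessLib

/-!
# `FibrewiseClosedPoints` — support lemmas: the trace ideal of a blow-up centre cuts out exactly
the singular locus (exact centre `τ(J) = J·J⁻¹`)

Helper lemmas for crux `stmt-ResolutionOfSingularities-15960`
(`Summit.ResolutionOfSingularities.ResolutionOfSingularities.Theses.SectionAscent.FibrewiseClosedPoints`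
≡ strong one-shot affine resolution `OneShotAffine`), filed by the line lead (c2, 2026-08-17) in
support of the re-centering / trace-ideal-untwist mechanism recorded on the item
(`Cruxes/FibrewiseClosedPoints/ExactCentre.md`, idea `trace-ideal-untwist`): given a blowing up
`Bl_J(Spec A)` that is REGULAR and whose centre `J` is principal at every regular prime (the ideal
form of "an isomorphism over `Reg`"), the TRACE IDEAL
`τ(J) = Σ_{φ ∈ Hom_A(J,A)} φ(J) = J·J⁻¹` has zero set EXACTLY the singular locus of `Spec A`.
This is the step that manufactures an exact centre (`V(τ(J)) = Sing`) out of a strong projective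
resolution; the rest of the mechanism is blow-up bookkeeping (Stacks 080A/080B, in the tree).
No `Prop` is defined; the trace ideal is written out as `Ideal.span {r | ∃ φ j, φ j = r}` (the
spelling of `Literature.RingTheory.LocalCohomology.CechFiniteness`).

* `map_eq_span_of_hom_apply_not_mem`, `isPrincipal_map_of_hom_apply_not_mem` — if some
  `φ : J → A` takes a value outside `𝔭`, then `J A_𝔭 = (j)` is principal (the identity
  `φ(j)·x = φ(x)·j` on an ideal).
* `span_hom_le_iff_not_isPrincipal` — **`τ(J) ⊆ 𝔭 ↔ J A_𝔭` is not principal** (`J` with a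
  regular element, `A` Noetherian; `→` is the tree's `CechFiniteness.exists_hom_apply_not_mem`).
* `isRegularLocalRing_of_isPrincipal_map` — **if `Bl_J(Spec A)` is regular and `J A_𝔭 = (a)` is
  principal (`J ≠ 0`, `A` a domain), then `A_𝔭` is regular**: `A ⊆ A[J/a] ⊆ A_𝔭` inside `Frac A`,
  so `A_𝔭` is a local ring of the chart `D₊(at) = Spec A[J/a]` of the blowing up.
* `le_of_not_isRegularLocalRing` — hence a regular blowing up has `V(J) ⊇ Sing` automatically.
* `span_hom_le_iff_not_isRegularLocalRing` — **`V(τ(J)) = Sing(Spec A)` exactly** when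
  `Bl_J` is regular and `J` is principal at the regular primes;
  `traceIdeal_le_iff_not_isRegularLocalRing` — the same at universe `0` with explicit binders
  (the registered helper signature).

## Sources
* H. Lindo, *Trace ideals and centers of endomorphism rings of modules over commutative rings*,
  J. Algebra 482 (2017), §2 (trace ideal vs. free summands / principal locus). [Lindo2017]
* The Stacks Project, Tag 0804 (affine blowup algebras `A[J/a]`). [StacksProject]
* J. Kollár, J. Witaszek, *Resolution and alteration with ample exceptional divisor*,
  arXiv:2102.03162 (the dual-sheaf device `Hom(L, 𝒪)`). [KollarWitaszek2021]
-/

noncomputable section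

set_option linter.dupNamespace false
set_option maxSynthPendingDepth 3

open AlgebraicGeometry CategoryTheory Literature.AlgebraicGeometry.Resolution

namespace Summit.ResolutionOfSingularities.ResolutionOfSingularities.Theorems.SectionAscent.TraceIdeal

universe u

/-! ## Pure algebra: values of homomorphisms `J → A` versus principality of `J A_𝔭` -/

section Algebra

variable {A : Type u} [CommRing A]

/-- The identity `φ(j) · x = φ(x) · j` for a linear form on an ideal and two of its elements
(both sides are `φ` of the element `j x = x j` of `J`). [folklore] -/
theorem hom_apply_mul_comm (J : Ideal A) (φ : J →ₗ[A] A) (j x : J) :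
    φ j * (x : A) = φ x * (j : A) := by
  have h1 : φ ((x : A) • j) = (x : A) * φ j := by rw [map_smul, smul_eq_mul]
  have h2 : φ ((j : A) • x) = (j : A) * φ x := by rw [map_smul, smul_eq_mul]
  have h3 : (x : A) • j = (j : A) • x := by
    apply Subtype.ext
    change (x : A) * (j : A) = (j : A) * (x : A)
    exact mul_comm _ _
  rw [mul_comm (φ j), ← h1, h3, h2, mul_comm]

/-- **A value of a linear form outside `𝔭` makes `J A_𝔭` principal, generated by `j`.** If
`φ : J → A` and `j ∈ J` have `φ(j) ∉ 𝔭`, then `J A_𝔭 = (j/1)`: for `x ∈ J`,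
`x = j · φ(x) · φ(j)⁻¹` in `A_𝔭`. [cite: Lindo2017, §2] -/
theorem map_eq_span_of_hom_apply_not_mem (J : Ideal A) (𝔭 : Ideal A) [𝔭.IsPrime]
    (φ : J →ₗ[A] A) (j : J) (hφ : φ j ∉ 𝔭) :
    J.map (algebraMap A (Localization.AtPrime 𝔭)) =
      Ideal.span {algebraMap A (Localization.AtPrime 𝔭) j} := by
  set S := Localization.AtPrime 𝔭
  apply le_antisymm
  · rw [Ideal.map_le_iff_le_comap]
    intro x hx
    rw [Ideal.mem_comap, Ideal.mem_span_singleton']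
    have hu : IsUnit (algebraMap A S (φ j)) :=
      IsLocalization.map_units (M := 𝔭.primeCompl) S ⟨φ j, hφ⟩
    refine ⟨algebraMap A S (φ ⟨x, hx⟩) * hu.unit⁻¹, ?_⟩
    have key : φ j * x = φ ⟨x, hx⟩ * (j : A) := hom_apply_mul_comm J φ j ⟨x, hx⟩
    calc algebraMap A S (φ ⟨x, hx⟩) * ↑hu.unit⁻¹ * algebraMap A S j
        = ↑hu.unit⁻¹ * algebraMap A S (φ ⟨x, hx⟩ * (j : A)) := by rw [map_mul]; ring
      _ = ↑hu.unit⁻¹ * algebraMap A S (φ j * x) := by rw [key]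
      _ = ↑hu.unit⁻¹ * ↑hu.unit * algebraMap A S x := by rw [map_mul, IsUnit.unit_spec, mul_assoc]
      _ = algebraMap A S x := by rw [Units.inv_mul, one_mul]
  · rw [Ideal.span_le, Set.singleton_subset_iff]
    exact Ideal.mem_map_of_mem _ j.2

/-- If some `φ : J → A` takes a value outside `𝔭` on `J`, then `J A_𝔭` is principal.
[cite: Lindo2017, §2] -/
theorem isPrincipal_map_of_hom_apply_not_mem (J : Ideal A) (𝔭 : Ideal A) [𝔭.IsPrime]
    (φ : J →ₗ[A] A) (j : J) (hφ : φ j ∉ 𝔭) :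
    (J.map (algebraMap A (Localization.AtPrime 𝔭))).IsPrincipal := by
  rw [map_eq_span_of_hom_apply_not_mem J 𝔭 φ j hφ]
  exact ⟨⟨_, rfl⟩⟩

/-- **The trace ideal `τ(J) = Σ_φ φ(J)` lies in `𝔭` iff `J A_𝔭` is not principal** (`A`
Noetherian, `J` containing a regular element): `→` is the lifting of the isomorphism
`J A_𝔭 ≅ A_𝔭` to a form `J → A` (`CechFiniteness.exists_hom_apply_not_mem`), `←` is
`isPrincipal_map_of_hom_apply_not_mem`. [cite: Lindo2017, §2] -/
theorem span_hom_le_iff_not_isPrincipal [IsNoetherianRing A] (J : Ideal A)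
    (hreg : ∃ c ∈ J, c ∈ nonZeroDivisors A) (𝔭 : Ideal A) [𝔭.IsPrime] :
    Ideal.span {r : A | ∃ (φ : J →ₗ[A] A) (j : J), φ j = r} ≤ 𝔭 ↔
      ¬ (J.map (algebraMap A (Localization.AtPrime 𝔭))).IsPrincipal := by
  constructor
  · intro hle hP
    obtain ⟨φ, j, hj⟩ := Literature.RingTheory.LocalCohomology.exists_hom_apply_not_mem J hreg 𝔭 hP
    exact hj (hle (Ideal.subset_span ⟨φ, j, rfl⟩))
  · intro hP
    rw [Ideal.span_le]
    rintro _ ⟨φ, j, rfl⟩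
    by_contra hj
    exact hP (isPrincipal_map_of_hom_apply_not_mem J 𝔭 φ j hj)

end Algebra

/-! ## The blowing up: a regular `Bl_J(Spec A)` is regular over the principal locus of `J` -/

section Blowup

open HomogeneousLocalization

variable {A : Type u} [CommRing A] [IsDomain A]

omit [IsDomain A] in
/-- A generator of a principal `J A_𝔭` can be taken from `J`: `J A_𝔭 = (a/1)` with `a ∈ J`.
[folklore] -/
theorem exists_mem_map_eq_span (J : Ideal A) (𝔭 : Ideal A) [𝔭.IsPrime]
    (hP : (J.map (algebraMap A (Localization.AtPrime 𝔭))).IsPrincipal) :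
    ∃ a ∈ J, J.map (algebraMap A (Localization.AtPrime 𝔭)) =
      Ideal.span {algebraMap A (Localization.AtPrime 𝔭) a} := by
  set S := Localization.AtPrime 𝔭
  obtain ⟨g, hg⟩ := hP
  have hgmem : g ∈ J.map (algebraMap A S) := by rw [hg]; exact Ideal.mem_span_singleton_self g
  obtain ⟨⟨⟨a, haJ⟩, sg⟩, hs⟩ := (IsLocalization.mem_map_algebraMap_iff 𝔭.primeCompl S).mp hgmem
  refine ⟨a, haJ, ?_⟩
  simp only at hs
  rw [hg, ← hs]
  exact (Ideal.span_singleton_mul_right_unit (IsLocalization.map_units S sg) g).symm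

/-- **The chart ring maps into `A_𝔭` when `J A_𝔭 = (a/1)`.** For `0 ≠ a ∈ J` with
`J A_𝔭 = (a/1)` there is an injective ring map `ψ : (A[Jt])_{(at)} = A[J/a] → A_𝔭` compatible
with the structure maps from `A`: inside `K = Frac A`, `θ((x tᵐ)/(a t)ᵐ) = x/aᵐ` lies in `A_𝔭`
because `x ∈ Jᵐ ⊆ aᵐA_𝔭`. [cite: StacksProject, Tag 0804] -/
theorem exists_ringHom_chart_of_map_eq_span (J : Ideal A) (𝔭 : Ideal A) [𝔭.IsPrime] {a : A}
    (haJ : a ∈ J) (ha0 : a ≠ 0)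
    (hmap : J.map (algebraMap A (Localization.AtPrime 𝔭)) =
      Ideal.span {algebraMap A (Localization.AtPrime 𝔭) a}) :
    ∃ ψ : HomogeneousLocalization.Away (reesGrading J) (reesT a haJ) →+* Localization.AtPrime 𝔭,
      Function.Injective ψ ∧ ∀ r : A, ψ (reesChartBase a haJ r) = algebraMap A _ r := by
  classical
  -- `ι : A[1/a] → K` and `φ𝔭 : A_𝔭 → K`, both injective (domain)
  have hpow : Submonoid.powers a ≤ nonZeroDivisors A :=
    powers_le_nonZeroDivisors_of_noZeroDivisors ha0
  letI algAK : Algebra (Localization.Away a) (FractionRing A) :=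
    IsLocalization.localizationAlgebraOfSubmonoidLe (Localization.Away a) (FractionRing A)
      (Submonoid.powers a) (nonZeroDivisors A) hpow
  haveI : IsScalarTower A (Localization.Away a) (FractionRing A) :=
    IsLocalization.localization_isScalarTower_of_submonoid_le (Localization.Away a) (FractionRing A)
      (Submonoid.powers a) (nonZeroDivisors A) hpow
  haveI : IsFractionRing (Localization.Away a) (FractionRing A) :=
    IsFractionRing.isFractionRing_of_isDomain_of_isLocalization (Submonoid.powers a)
      (Localization.Away a) (FractionRing A)
  have hι : ∀ r : A, algebraMap (Localization.Away a) (FractionRing A)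
      (algebraMap A (Localization.Away a) r) = algebraMap A (FractionRing A) r := fun r =>
    (IsScalarTower.algebraMap_apply A (Localization.Away a) (FractionRing A) r).symm
  have hιinj : Function.Injective (algebraMap (Localization.Away a) (FractionRing A)) :=
    IsFractionRing.injective (Localization.Away a) (FractionRing A)
  have hφ : ∀ r : A, algebraMap (Localization.AtPrime 𝔭) (FractionRing A)
      (algebraMap A (Localization.AtPrime 𝔭) r) = algebraMap A (FractionRing A) r := fun r =>
    (IsScalarTower.algebraMap_apply A (Localization.AtPrime 𝔭) (FractionRing A) r).symm
  have hφinj : Function.Injective (algebraMap (Localization.AtPrime 𝔭) (FractionRing A)) :=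
    IsFractionRing.injective (Localization.AtPrime 𝔭) (FractionRing A)
  -- `θ : C → K`
  let θ : HomogeneousLocalization.Away (reesGrading J) (reesT a haJ) →+* FractionRing A :=
    (algebraMap (Localization.Away a) (FractionRing A)).comp (reesChart a haJ)
  have hθ : ∀ y, θ y = algebraMap (Localization.Away a) (FractionRing A) (reesChart a haJ y) :=
    fun _ => rfl
  -- `θ` is injective: `C → A[1/a]` is a localization at the nonzerodivisor `a/1`
  have hθinj : Function.Injective θ := by
    refine hιinj.comp ?_
    letI := (reesChart a haJ).toAlgebra
    haveI := isLocalization_reesChart a haJ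
    exact IsLocalization.injective (M := Submonoid.powers (reesChartBase a haJ a))
      (Localization.Away a) (Submonoid.powers_le.mpr (reesChartBase_mem_nonZeroDivisors a haJ))
  -- the image of `θ` lies in `A_𝔭`
  have hJpow : ∀ (m : ℕ) (x : A), x ∈ J ^ m → ∃ z : Localization.AtPrime 𝔭,
      z * algebraMap A (Localization.AtPrime 𝔭) a ^ m = algebraMap A (Localization.AtPrime 𝔭) x := by
    intro m x hx
    have : algebraMap A (Localization.AtPrime 𝔭) x ∈
        (J.map (algebraMap A (Localization.AtPrime 𝔭))) ^ m := by
      rw [← Ideal.map_pow]; exact Ideal.mem_map_of_mem _ hx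
    rw [hmap, Ideal.span_singleton_pow] at this
    exact Ideal.mem_span_singleton'.mp this
  have haK : ∀ m : ℕ, algebraMap A (FractionRing A) a ^ m ≠ 0 := fun m =>
    pow_ne_zero _ ((map_ne_zero_iff _ (IsFractionRing.injective A (FractionRing A))).mpr ha0)
  have hrange : ∀ y, ∃ z : Localization.AtPrime 𝔭,
      algebraMap (Localization.AtPrime 𝔭) (FractionRing A) z = θ y := by
    intro y
    obtain ⟨m, p, hp, rfl⟩ :=
      HomogeneousLocalization.Away.mk_surjective (reesGrading J) (reesT_mem a haJ) y
    obtain ⟨x, hx⟩ := (mem_reesGrading_iff J).mp hp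
    have hxJ : x ∈ J ^ (m • 1) := reesAlgebra.monomial_mem.mp (hx ▸ p.2)
    rw [smul_eq_mul, mul_one] at hxJ
    obtain ⟨z, hz⟩ := hJpow m x hxJ
    refine ⟨z, ?_⟩
    have h1 := reesChart_mk_mul_pow a haJ m p hp
    rw [reesEval_of_eq_monomial a hx.symm] at h1
    have h3 : θ (HomogeneousLocalization.Away.mk (reesGrading J) (reesT_mem a haJ) m p hp) *
        algebraMap A (FractionRing A) a ^ m = algebraMap A (FractionRing A) x := by
      have := congrArg (algebraMap (Localization.Away a) (FractionRing A)) h1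
      rwa [map_mul, map_pow, hι, hι] at this
    have h4 : algebraMap (Localization.AtPrime 𝔭) (FractionRing A) z *
        algebraMap A (FractionRing A) a ^ m = algebraMap A (FractionRing A) x := by
      have := congrArg (algebraMap (Localization.AtPrime 𝔭) (FractionRing A)) hz
      rwa [map_mul, map_pow, hφ, hφ] at this
    exact mul_right_cancel₀ (haK m) (h4.trans h3.symm)
  -- `ψ : C → A_𝔭` through the range of `φ𝔭`
  choose g hg using hrange
  have hg_add : ∀ y₁ y₂, g (y₁ + y₂) = g y₁ + g y₂ := fun y₁ y₂ =>
    hφinj (by rw [map_add, hg, hg, hg, map_add])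
  have hg_mul : ∀ y₁ y₂, g (y₁ * y₂) = g y₁ * g y₂ := fun y₁ y₂ =>
    hφinj (by rw [map_mul, hg, hg, hg, map_mul])
  have hg_one : g 1 = 1 := hφinj (by rw [hg, map_one, map_one])
  have hg_zero : g 0 = 0 := hφinj (by rw [hg, map_zero, map_zero])
  let ψ : HomogeneousLocalization.Away (reesGrading J) (reesT a haJ) →+* Localization.AtPrime 𝔭 :=
    { toFun := g, map_one' := hg_one, map_mul' := hg_mul, map_zero' := hg_zero, map_add' := hg_add }
  refine ⟨ψ, fun y₁ y₂ h => hθinj (by rw [← hg, ← hg]; exact congrArg _ h), fun r => hφinj ?_⟩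
  change algebraMap _ _ (g _) = _
  rw [hg, hφ, hθ, reesChart_reesChartBase, hι]

omit [IsDomain A] in
/-- **`A_𝔭` is a local ring of the chart, hence regular.** If an injective ring map
`ψ : (A[Jt])_{(at)} → A_𝔭` is compatible with the structure maps from `A`, then `A_𝔭` is the
localization of the chart ring at `q = ψ⁻¹(𝔭A_𝔭)`, i.e. the stalk of `Bl_J(Spec A)` at the point
`q` of the chart `D₊(at)`; so it is regular when the blowing up is. [cite: StacksProject, Tag 0804] -/
theorem isRegularLocalRing_of_ringHom_chart (J : Ideal A) {a : A} (haJ : a ∈ J)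
    (hreg : Scheme.IsRegular (affineBlowup J)) (𝔭 : Ideal A) [𝔭.IsPrime]
    (ψ : HomogeneousLocalization.Away (reesGrading J) (reesT a haJ) →+* Localization.AtPrime 𝔭)
    (hψinj : Function.Injective ψ) (hψbase : ∀ r : A, ψ (reesChartBase a haJ r) = algebraMap A _ r) :
    IsRegularLocalRing (Localization.AtPrime 𝔭) := by
  letI : Algebra (HomogeneousLocalization.Away (reesGrading J) (reesT a haJ))
    (Localization.AtPrime 𝔭) := ψ.toAlgebra
  let q : Ideal (HomogeneousLocalization.Away (reesGrading J) (reesT a haJ)) :=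
    (IsLocalRing.maximalIdeal (Localization.AtPrime 𝔭)).comap ψ
  haveI hq : q.IsPrime := Ideal.comap_isPrime ψ _
  haveI : IsLocalization.AtPrime (Localization.AtPrime 𝔭) q :=
    { map_units := by
        rintro ⟨y, hy⟩
        change IsUnit (ψ y)
        by_contra hu
        exact hy ((IsLocalRing.mem_maximalIdeal _).mpr hu)
      surj := by
        intro z
        obtain ⟨⟨r, s⟩, hz⟩ := IsLocalization.surj 𝔭.primeCompl z
        refine ⟨⟨reesChartBase a haJ r, ⟨reesChartBase a haJ s, ?_⟩⟩, ?_⟩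
        · change ψ (reesChartBase a haJ s) ∉ IsLocalRing.maximalIdeal _
          rw [hψbase]
          exact fun h => (IsLocalRing.mem_maximalIdeal _).mp h (IsLocalization.map_units _ s)
        · change z * ψ (reesChartBase a haJ s) = ψ (reesChartBase a haJ r)
          rw [hψbase, hψbase]
          exact hz
      exists_of_eq := by
        intro y₁ y₂ h
        exact ⟨1, by rw [hψinj h]⟩ }
  -- the point `q` of the chart `D₊(at)`: its stalk is `C_q` (open immersion `Spec C → Bl_J`)
  let x : affineBlowup J := Proj.awayι (reesGrading J) (reesT a haJ) (reesT_mem a haJ) one_pos ⟨q, hq⟩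
  haveI hx : IsRegularLocalRing ((affineBlowup J).presheaf.stalk x) := hreg x
  let e : (affineBlowup J).presheaf.stalk x ≃+* Localization.AtPrime q :=
    ((asIso ((Proj.awayι (reesGrading J) (reesT a haJ) (reesT_mem a haJ) one_pos).stalkMap
        ⟨q, hq⟩)).commRingCatIsoToRingEquiv).trans
      (Spec.stalkIso (CommRingCat.of (HomogeneousLocalization.Away (reesGrading J) (reesT a haJ)))
        ⟨q, hq⟩).commRingCatIsoToRingEquiv
  haveI hstalk : IsRegularLocalRing (Localization.AtPrime q) := IsRegularLocalRing.of_ringEquiv e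
  -- and `C_q ≅ A_𝔭` (both are localizations of `C` at `q`)
  exact IsRegularLocalRing.of_ringEquiv
    (IsLocalization.algEquiv q.primeCompl (Localization.AtPrime q) (Localization.AtPrime 𝔭)).toRingEquiv

/-- **If `Bl_J(Spec A)` is regular and `J A_𝔭` is principal, then `A_𝔭` is regular** (`A` a
domain, `J ≠ 0`). Write `J A_𝔭 = (a/1)` with `0 ≠ a ∈ J`; inside `K = Frac A` one has
`A ⊆ A[J/a] ⊆ A_𝔭` (as `j/aᵐ ∈ A_𝔭` for `j ∈ Jᵐ`), so `A_𝔭` is the local ring of the chart ring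
`A[J/a] = (A[Jt])_{(at)}` at the prime `𝔭A_𝔭 ∩ A[J/a]`, i.e. a stalk of the blowing up on the
chart `D₊(at)`; regularity of that stalk is the hypothesis. [cite: StacksProject, Tag 0804] -/
theorem isRegularLocalRing_of_isPrincipal_map (J : Ideal A) (hJ : J ≠ ⊥)
    (hreg : Scheme.IsRegular (affineBlowup J)) (𝔭 : Ideal A) [𝔭.IsPrime]
    (hP : (J.map (algebraMap A (Localization.AtPrime 𝔭))).IsPrincipal) :
    IsRegularLocalRing (Localization.AtPrime 𝔭) := by
  obtain ⟨a, haJ, hmap⟩ := exists_mem_map_eq_span J 𝔭 hP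
  have ha0 : a ≠ 0 := by
    rintro rfl
    apply hJ
    rw [map_zero, Ideal.span_singleton_eq_bot.mpr rfl] at hmap
    exact (Ideal.map_eq_bot_iff_of_injective
      (IsLocalization.injective (Localization.AtPrime 𝔭) 𝔭.primeCompl_le_nonZeroDivisors)).mp hmap
  obtain ⟨ψ, hψinj, hψbase⟩ := exists_ringHom_chart_of_map_eq_span J 𝔭 haJ ha0 hmap
  exact isRegularLocalRing_of_ringHom_chart J haJ hreg 𝔭 ψ hψinj hψbase

/-- **A regular blowing up has `V(J) ⊇ Sing(Spec A)`**: if `Bl_J(Spec A)` is regular (`J ≠ 0`,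
`A` a domain) then `J ≤ 𝔭` for every non-regular prime `𝔭` (off `V(J)` the blowing up is an
isomorphism onto a regular scheme). [folklore] -/
theorem le_of_not_isRegularLocalRing (J : Ideal A) (hJ : J ≠ ⊥)
    (hreg : Scheme.IsRegular (affineBlowup J)) (𝔭 : Ideal A) [𝔭.IsPrime]
    (h : ¬ IsRegularLocalRing (Localization.AtPrime 𝔭)) : J ≤ 𝔭 := by
  by_contra hle
  apply h
  apply isRegularLocalRing_of_isPrincipal_map J hJ hreg 𝔭
  have htop : J.map (algebraMap A (Localization.AtPrime 𝔭)) = ⊤ := by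
    rw [Ideal.eq_top_iff_one]
    obtain ⟨s, hsJ, hs𝔭⟩ := Set.not_subset.mp hle
    have hu : IsUnit (algebraMap A (Localization.AtPrime 𝔭) s) :=
      IsLocalization.map_units (M := 𝔭.primeCompl) _ ⟨s, hs𝔭⟩
    have := Ideal.mem_map_of_mem (algebraMap A (Localization.AtPrime 𝔭)) hsJ
    exact (Ideal.eq_top_of_isUnit_mem _ this hu) ▸ Submodule.mem_top
  rw [htop]
  exact ⟨⟨1, by rw [Ideal.submodule_span_eq, Ideal.span_singleton_one]⟩⟩

/-- **The trace ideal cuts out exactly the singular locus.** For a Noetherian domain `A` and a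
non-zero ideal `J` whose blowing up `Bl_J(Spec A)` is regular and which is principal at every
regular prime (the ideal form of "`Bl_J → Spec A` is an isomorphism over `Reg`"), the trace ideal
`τ(J) = Σ_{φ ∈ Hom(J,A)} φ(J) = J·J⁻¹` satisfies `τ(J) ⊆ 𝔭 ↔ A_𝔭` is not regular, i.e.
`V(τ(J)) = Sing(Spec A)` on the nose — the exact-support clause of `OneShot` for the centre
`τ(J)` (whose blowing up `Bl_{τ(J)} = Bl_{(a):J}(Bl_J)` is the blowing up of the REGULAR `Bl_J`
along a codimension-`≥ 2` ideal; `Cruxes/FibrewiseClosedPoints/ExactCentre.md`).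
[cite: KollarWitaszek2021, Lemma 8 (the dual-sheaf device)] -/
theorem span_hom_le_iff_not_isRegularLocalRing [IsNoetherianRing A] (J : Ideal A) (hJ : J ≠ ⊥)
    (hreg : Scheme.IsRegular (affineBlowup J))
    (hprin : ∀ 𝔭 : PrimeSpectrum A, IsRegularLocalRing (Localization.AtPrime 𝔭.asIdeal) →
      (J.map (algebraMap A (Localization.AtPrime 𝔭.asIdeal))).IsPrincipal)
    (𝔭 : PrimeSpectrum A) :
    Ideal.span {r : A | ∃ (φ : J →ₗ[A] A) (j : J), φ j = r} ≤ 𝔭.asIdeal ↔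
      ¬ IsRegularLocalRing (Localization.AtPrime 𝔭.asIdeal) := by
  have hreg' : ∃ c ∈ J, c ∈ nonZeroDivisors A := by
    obtain ⟨c, hcJ, hc0⟩ := J.ne_bot_iff.mp hJ
    exact ⟨c, hcJ, mem_nonZeroDivisors_of_ne_zero hc0⟩
  rw [span_hom_le_iff_not_isPrincipal J hreg' 𝔭.asIdeal, not_iff_not]
  exact ⟨fun hP => isRegularLocalRing_of_isPrincipal_map J hJ hreg 𝔭.asIdeal hP, hprin 𝔭⟩

end Blowup

/-! ## Registered form (universe `0`, explicit binders: the crux quantifies over `A : Type`) -/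

/-- **`V(τ(J)) = Sing(Spec A)` exactly** — registered helper of crux
`stmt-ResolutionOfSingularities-15960` (fact (A) of the trace-ideal untwist /
`Cruxes/FibrewiseClosedPoints/ExactCentre.md` Step 3): for a Noetherian domain `A : Type` and a
non-zero ideal `J` with `Bl_J(Spec A)` regular and `J` principal at every regular prime, the trace
ideal `Σ_{φ ∈ Hom(J,A)} φ(J)` lies in `𝔭` iff `A_𝔭` is not regular.
[cite: KollarWitaszek2021, Lemma 8 (the dual-sheaf device)] -/
theorem traceIdeal_le_iff_not_isRegularLocalRing (A : Type) [CommRing A] [IsDomain A]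
    [IsNoetherianRing A] (J : Ideal A) (hJ : J ≠ ⊥)
    (hreg : Literature.AlgebraicGeometry.Resolution.Scheme.IsRegular
      (Literature.AlgebraicGeometry.Resolution.affineBlowup J))
    (hprin : ∀ 𝔭 : PrimeSpectrum A, IsRegularLocalRing (Localization.AtPrime 𝔭.asIdeal) →
      (J.map (algebraMap A (Localization.AtPrime 𝔭.asIdeal))).IsPrincipal)
    (𝔭 : PrimeSpectrum A) :
    Ideal.span {r : A | ∃ (φ : J →ₗ[A] A) (j : J), φ j = r} ≤ 𝔭.asIdeal ↔
      ¬ IsRegularLocalRing (Localization.AtPrime 𝔭.asIdeal) :=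
  span_hom_le_iff_not_isRegularLocalRing J hJ hreg hprin 𝔭

end Summit.ResolutionOfSingularities.ResolutionOfSingularities.Theorems.SectionAscent.TraceIdeal

end
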